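import Summits.KontsevichZagierPeriods.KontsevichZagierPeriods.Theorems.HurwitzMicroSectorsNormalFormPrincipleM2FiveZetaTwo

/-!
# `NormalFormPrinciple` (stmt-KontsevichZagierPeriods-3869), line `SketchIdeator1` — leaf
# `stub_boxRigidity`, the cyclotomic log layer: peeling one cyclotomic factor off an unfolded
# log monomial

Registered sub-goal `cyclo_peel` of the cyclotomic log layer (lead file `…CycloLog`). Write
`σ = {0 < x < 1} ⊆ ℝ¹` and, for `c ∈ ℚ` and an edge `v ≥ 1` on `σ`,
`M(c/x, v) = [{x ∈ σ, 1 ≤ s ≤ v x}, (c/x)/s]` for any integral representation with this `KZlog.band`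
as domain and this integrand on it (the unfolded log monomial `∫₀¹ (c/x) log v(x) dx`). For a
`ℚ`-semialgebraic edge `V ≥ 1` on `(0,1)` and the cyclotomic-type factors
`H_{d+1}(x) = 1/(1 − x^{d+1})` and `G_{d+1}(x) = 1 + x + ⋯ + x^d` (both `≥ 1` on `(0,1)`), the
unfolded product rule `log (u w) = log u + log w` of the KZ calculus
(`KZ.of_sub_of_sub_mem_relations_mul`: rule 1a, splitting the band at `s = u x`, and rule 2, the
substitution `s = u(x) s'`) gives `M(c/x, V·H_{d+1}) − M(c/x, V) − M(c/x, H_{d+1}) ∈ relations` and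
`M(c/x, V·G_{d+1}) − M(c/x, V) − M(c/x, G_{d+1}) ∈ relations`.
References: M. Kontsevich, D. Zagier, *Periods* (2001), §1.2, rules (1), (2). No new definitions.
-/

noncomputable section

open MeasureTheory Set
open Literature.NumberTheory.Transcendental Literature.NumberTheory.Transcendental.KZ
open Literature.ModelTheory.ExponentialFields (IsSemialgebraic)

namespace Summit.KontsevichZagierPeriods.HurwitzMicroSectors.NormalFormPrinciple.PiBox.M2

/-- `H_{d+1}(x) = 1/(1 − x^{d+1}) ≥ 1` on `σ = (0,1) ⊆ ℝ¹`. [folklore] -/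
theorem one_le_one_div_one_sub_pow_succ (d : ℕ) :
    ∀ y ∈ {y : Fin 1 → ℝ | 0 < y 0 ∧ y 0 < 1}, (1:ℝ) ≤ 1 / (1 - y 0 ^ (d + 1)) := by
  intro y hy
  have h : y 0 ^ (d + 1) < 1 := pow_lt_one₀ hy.1.le hy.2 d.succ_ne_zero
  exact one_le_one_div (sub_pos.2 h) (by linarith [pow_pos hy.1 (d + 1)])

/-- `G_{d+1}(x) = ∑_{i ≤ d} xⁱ` is `ℚ`-semialgebraic on `σ = (0,1) ⊆ ℝ¹` (a polynomial).
[folklore] -/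
theorem isSemialgebraicFunOn_geomSum (d : ℕ) :
    IsSemialgebraicFunOn ℚ {y : Fin 1 → ℝ | 0 < y 0 ∧ y 0 < 1}
      (fun y => ∑ i ∈ Finset.range (d + 1), y 0 ^ i) :=
  (isSemialgebraicFunOn_aeval isSemialgebraic_unitInterval_fin_one
    (∑ i ∈ Finset.range (d + 1), MvPolynomial.X 0 ^ i : MvPolynomial (Fin 1) ℚ)).congr
    fun y _ => by simp [map_sum]

/-- `G_{d+1}(x) = ∑_{i ≤ d} xⁱ ≥ 1` on `σ = (0,1) ⊆ ℝ¹` (the `i = 0` term is `1`, the others are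
nonnegative). [folklore] -/
theorem one_le_geomSum (d : ℕ) :
    ∀ y ∈ {y : Fin 1 → ℝ | 0 < y 0 ∧ y 0 < 1}, (1:ℝ) ≤ ∑ i ∈ Finset.range (d + 1), y 0 ^ i := by
  intro y hy
  rw [Finset.sum_range_succ', pow_zero]
  exact le_add_of_nonneg_left (Finset.sum_nonneg fun i _ => pow_nonneg hy.1.le _)

/-- **Peeling `H_{d+1}`:** for a `ℚ`-semialgebraic edge `V ≥ 1` on `(0,1)`,
`M(c/x, V·H_{d+1}) − M(c/x, V) − M(c/x, H_{d+1}) ∈ relations`, `H_{d+1}(x) = 1/(1 − x^{d+1})` — one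
instance of the unfolded product rule `KZ.of_sub_of_sub_mem_relations_mul` with weight `g = c/x`.
[cite: KontsevichZagier2001, §1.2] -/
theorem cyclo_peel_H (c : ℚ) (d : ℕ) (V : ℝ → ℝ)
    (hV : IsSemialgebraicFunOn ℚ {y : Fin 1 → ℝ | 0 < y 0 ∧ y 0 < 1} (fun y => V (y 0)))
    (hV1 : ∀ x ∈ Set.Ioo (0:ℝ) 1, 1 ≤ V x) (R R₁ Hd : IntegralRep 2)
    (hRd : R.domain = KZlog.band {y : Fin 1 → ℝ | 0 < y 0 ∧ y 0 < 1} (fun _ => (1:ℝ))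
      (fun y => V (y 0) * (1 / (1 - y 0 ^ (d + 1)))))
    (hRi : EqOn R.integrand (fun z => ((c : ℝ) / z 0) / z 1) R.domain)
    (hR₁d : R₁.domain = KZlog.band {y : Fin 1 → ℝ | 0 < y 0 ∧ y 0 < 1} (fun _ => (1:ℝ))
      (fun y => V (y 0)))
    (hR₁i : EqOn R₁.integrand (fun z => ((c : ℝ) / z 0) / z 1) R₁.domain)
    (hHdd : Hd.domain = KZlog.band {y : Fin 1 → ℝ | 0 < y 0 ∧ y 0 < 1} (fun _ => (1:ℝ))
      (fun y => 1 / (1 - y 0 ^ (d + 1))))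
    (hHdi : EqOn Hd.integrand (fun z => ((c : ℝ) / z 0) / z 1) Hd.domain) :
    of R - of R₁ - of Hd ∈ relations :=
  KZ.of_sub_of_sub_mem_relations_mul (g := fun y => (c : ℝ) / y 0) (u := fun y => V (y 0))
    (w := fun y => 1 / (1 - y 0 ^ (d + 1))) isSemialgebraic_unitInterval_fin_one hV
    (isSemialgebraicFunOn_one_div_one_sub_pow d.succ_ne_zero)
    (fun y hy => hV1 (y 0) ⟨hy.1, hy.2⟩) (one_le_one_div_one_sub_pow_succ d)
    R R₁ Hd hRd hRi hR₁d hR₁i hHdd hHdi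

/-- **Peeling `G_{d+1}`:** for a `ℚ`-semialgebraic edge `V ≥ 1` on `(0,1)`,
`M(c/x, V·G_{d+1}) − M(c/x, V) − M(c/x, G_{d+1}) ∈ relations`, `G_{d+1}(x) = ∑_{i ≤ d} xⁱ` — one
instance of the unfolded product rule `KZ.of_sub_of_sub_mem_relations_mul` with weight `g = c/x`.
[cite: KontsevichZagier2001, §1.2] -/
theorem cyclo_peel_G (c : ℚ) (d : ℕ) (V : ℝ → ℝ)
    (hV : IsSemialgebraicFunOn ℚ {y : Fin 1 → ℝ | 0 < y 0 ∧ y 0 < 1} (fun y => V (y 0)))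
    (hV1 : ∀ x ∈ Set.Ioo (0:ℝ) 1, 1 ≤ V x) (R R₁ Gd : IntegralRep 2)
    (hRd : R.domain = KZlog.band {y : Fin 1 → ℝ | 0 < y 0 ∧ y 0 < 1} (fun _ => (1:ℝ))
      (fun y => V (y 0) * ∑ i ∈ Finset.range (d + 1), y 0 ^ i))
    (hRi : EqOn R.integrand (fun z => ((c : ℝ) / z 0) / z 1) R.domain)
    (hR₁d : R₁.domain = KZlog.band {y : Fin 1 → ℝ | 0 < y 0 ∧ y 0 < 1} (fun _ => (1:ℝ))
      (fun y => V (y 0)))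
    (hR₁i : EqOn R₁.integrand (fun z => ((c : ℝ) / z 0) / z 1) R₁.domain)
    (hGdd : Gd.domain = KZlog.band {y : Fin 1 → ℝ | 0 < y 0 ∧ y 0 < 1} (fun _ => (1:ℝ))
      (fun y => ∑ i ∈ Finset.range (d + 1), y 0 ^ i))
    (hGdi : EqOn Gd.integrand (fun z => ((c : ℝ) / z 0) / z 1) Gd.domain) :
    of R - of R₁ - of Gd ∈ relations :=
  KZ.of_sub_of_sub_mem_relations_mul (g := fun y => (c : ℝ) / y 0) (u := fun y => V (y 0))
    (w := fun y => ∑ i ∈ Finset.range (d + 1), y 0 ^ i) isSemialgebraic_unitInterval_fin_one hV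
    (isSemialgebraicFunOn_geomSum d) (fun y hy => hV1 (y 0) ⟨hy.1, hy.2⟩) (one_le_geomSum d)
    R R₁ Gd hRd hRi hR₁d hR₁i hGdd hGdi

/-- **Stub (peeling one cyclotomic factor, rules 1a + 2).** With
`M(c/x, v) = [{0 < x < 1, 1 ≤ s ≤ v x}, (c/x)/s]` (any representation with this band as domain and
this integrand on it), for `c ∈ ℚ`, `d ∈ ℕ` and a `ℚ`-semialgebraic edge `V ≥ 1` on `(0,1)`:
`M(c/x, V·H_{d+1}) ≡ M(c/x, V) + M(c/x, H_{d+1})` and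
`M(c/x, V·G_{d+1}) ≡ M(c/x, V) + M(c/x, G_{d+1})` modulo KZ relations, where
`H_{d+1}(x) = 1/(1 − x^{d+1})` and `G_{d+1}(x) = 1 + x + ⋯ + x^d` — two instances of the unfolded
product rule `log (u w) = log u + log w`. [cite: KontsevichZagier2001, §1.2] -/
theorem cyclo_peel (c : ℚ) (d : ℕ) (V : ℝ → ℝ)
    (hV : IsSemialgebraicFunOn ℚ {y : Fin 1 → ℝ | 0 < y 0 ∧ y 0 < 1} (fun y => V (y 0)))
    (hV1 : ∀ x ∈ Set.Ioo (0:ℝ) 1, 1 ≤ V x) :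
    (∀ (R R₁ Hd : IntegralRep 2),
      R.domain = KZlog.band {y : Fin 1 → ℝ | 0 < y 0 ∧ y 0 < 1} (fun _ => (1:ℝ))
        (fun y => V (y 0) * (1 / (1 - y 0 ^ (d + 1)))) →
      EqOn R.integrand (fun z => ((c : ℝ) / z 0) / z 1) R.domain →
      R₁.domain = KZlog.band {y : Fin 1 → ℝ | 0 < y 0 ∧ y 0 < 1} (fun _ => (1:ℝ))
        (fun y => V (y 0)) →
      EqOn R₁.integrand (fun z => ((c : ℝ) / z 0) / z 1) R₁.domain →
      Hd.domain = KZlog.band {y : Fin 1 → ℝ | 0 < y 0 ∧ y 0 < 1} (fun _ => (1:ℝ))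
        (fun y => 1 / (1 - y 0 ^ (d + 1))) →
      EqOn Hd.integrand (fun z => ((c : ℝ) / z 0) / z 1) Hd.domain →
      of R - of R₁ - of Hd ∈ relations) ∧
    (∀ (R R₁ Gd : IntegralRep 2),
      R.domain = KZlog.band {y : Fin 1 → ℝ | 0 < y 0 ∧ y 0 < 1} (fun _ => (1:ℝ))
        (fun y => V (y 0) * ∑ i ∈ Finset.range (d + 1), y 0 ^ i) →
      EqOn R.integrand (fun z => ((c : ℝ) / z 0) / z 1) R.domain →
      R₁.domain = KZlog.band {y : Fin 1 → ℝ | 0 < y 0 ∧ y 0 < 1} (fun _ => (1:ℝ))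
        (fun y => V (y 0)) →
      EqOn R₁.integrand (fun z => ((c : ℝ) / z 0) / z 1) R₁.domain →
      Gd.domain = KZlog.band {y : Fin 1 → ℝ | 0 < y 0 ∧ y 0 < 1} (fun _ => (1:ℝ))
        (fun y => ∑ i ∈ Finset.range (d + 1), y 0 ^ i) →
      EqOn Gd.integrand (fun z => ((c : ℝ) / z 0) / z 1) Gd.domain →
      of R - of R₁ - of Gd ∈ relations) :=
  ⟨cyclo_peel_H c d V hV hV1, cyclo_peel_G c d V hV hV1⟩

end Summit.KontsevichZagierPeriods.HurwitzMicroSectors.NormalFormPrinciple.PiBox.M2
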